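import Mathlib
import Literature.Combinatorics.Optimization.LpRelaxationsVersusSheraliAdamsProof
import Literature.Combinatorics.Optimization.MaxCutLpLowerBound
import HarnessLib

/-!
# Integrality gaps of polynomial-size LP relaxations of Max-CSPs (Chan–Lee–Raghavendra–Steurer
# 2013/2016, §1 and §3), UNCONDITIONAL — the integrality-gap reading of Theorem 3.1

[ChanEtAl2016, §1 (arXiv v3 p. 3)]: "we prove that every polynomial-sized LP for Max Cut has an
integrality gap of 1/2, answering a question from [BraunFPS12].  As another example, every such LP
for Max 3-Sat has an integrality gap of 7/8"; §2 (p. 6): "we also say that `𝓛` achieves an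
`α`-factor approximation if `𝓛(ℑ) ≤ α · opt(ℑ)` for all `ℑ`" (the tree's `LPRelaxation.AchievesRatio`,
`LPRelaxation.GapLT ρ` = "achieves some ratio `ρ' < ρ`", integrality gap `1/α`).

This file turns the PROVED Theorem 3.1 (`ChanEtAl2016_thm31_holds`,
`LpRelaxationsVersusSheraliAdamsProof.lean`) into integrality-gap statements, exactly as the KMR
files do for the weakly-exponential regime (`KothariMekaRaghavendra2017_cor15_*_of_thm110`, which
remain conditional on the untyped-proof fact `KothariMekaRaghavendra2017_thm110`):

* `poly_lpGap_of_linearSAGap` — a linear-round Sherali–Adams `(1 − ε, s₀ + ε)`-gap (`0 < s₀ < 1`)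
  forbids integrality gap `< 1/s₀ − ε` for LP relaxations of size `≤ n^{d/2}`, every `d`, all large
  `n` (via `LPRelaxation.GapLT.achieves`: gap `< ρ` ⇒ `(ρ s, s)`-approximation);
* **Max-`k`-SAT** `maxKSat_poly_lpGap` (`2^k/(2^k − 1) − ε`; `k = 3`: "7/8"),
  **Max-`k`-XOR** `maxKXor_poly_lpGap` (`2 − ε`), **parity-implied predicates**
  `parityImplied_poly_lpGap` (`2^k/|P⁻¹(1)| − ε`) — all UNCONDITIONAL (Schoenebeck inputs proved in
  the tree);
* **Max Cut** `maxCut_poly_lp_of_CMM`, `maxCut_poly_lpGap_of_CMM` (`2 − ε`, i.e. "integrality gap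
  1/2") — conditional on the single named fact `CharikarMakarychevMakarychev2009_maxCutSA` (the
  [CMM09] `n^γ`-round Sherali–Adams gap, `MaxCutLpLowerBound.lean`), which is the input the paper
  cites (p. 9: "known Sherali–Adams gaps for Max Cut [CMM09]").

Theorems only; 0 definitions, 0 new named facts.
-/

noncomputable section

open Finset

namespace Literature.Combinatorics.Optimization

/-- **Polynomial-size LPs inherit linear-round Sherali–Adams integrality gaps (UNCONDITIONAL).**  If
for every `ε > 0` the `⌊c_ε n⌋`-round Sherali–Adams relaxation of Max-`𝒫` fails to
`(1 − ε, s₀ + ε)`-approximate for all large `n`, where `0 < s₀ < 1`, then for every `ε > 0` and every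
`d ≥ max(1,k)`: for all large `n`, no LP relaxation of size `R ≤ n^{d/2}` on `n`-variable instances has
integrality gap less than `1/s₀ − ε`.
[cite: ChanEtAl2016, Thm 3.1 (arXiv v3 p. 9) with §2 (p. 6: "α-factor approximation")] -/
theorem poly_lpGap_of_linearSAGap {k : ℕ} (P : Set ((Fin k → Bool) → Bool)) {s₀ : ℝ}
    (hs₀ : 0 < s₀) (hs₁ : s₀ < 1)
    (hSAgap : ∀ ε : ℝ, 0 < ε → ∃ cε : ℝ, 0 < cε ∧ ∃ n₀ : ℕ, ∀ n : ℕ, n₀ ≤ n →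
      ¬ SAAchieves (n := n) P ⌊cε * n⌋₊ (1 - ε) (s₀ + ε))
    {ε : ℝ} (hε : 0 < ε) {d : ℕ} (hd : 1 ≤ d) (hkd : k ≤ d) :
    ∃ n₀ : ℕ, ∀ n : ℕ, n₀ ≤ n → ∀ R : ℕ, (R : ℝ) ≤ (n : ℝ) ^ ((d : ℝ) / 2) →
      ∀ L : LPRelaxation k n P R, ¬ L.GapLT (1 / s₀ - ε) := by
  -- WLOG `ε ≤ 1`; margin `δ = ε' s₀² / 2`
  set ε' : ℝ := min ε 1 with hε'
  have hε'0 : 0 < ε' := lt_min hε one_pos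
  have hε'1 : ε' ≤ 1 := min_le_right _ _
  have hε'ε : ε' ≤ ε := min_le_left _ _
  set δ : ℝ := ε' * s₀ ^ 2 / 2 with hδ
  have hδ0 : 0 < δ := by rw [hδ]; positivity
  have hs₀2 : s₀ ^ 2 ≤ s₀ := by nlinarith
  have hδ1 : δ ≤ 1 / 2 := by
    rw [hδ]
    have : ε' * s₀ ^ 2 ≤ 1 * 1 := by nlinarith
    linarith
  obtain ⟨n₀, hn₀⟩ := poly_lp_of_linearSAGap P hSAgap hδ0 hd hkd
  refine ⟨n₀, fun n hn R hR L hgap => hn₀ n hn R hR L ?_⟩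
  -- gap `< 1/s₀ − ε ≤ 1/s₀ − ε'` gives a `(1 − δ, s₀ + δ)`-approximation
  refine (hgap.mono (show 1 / s₀ - ε ≤ 1 / s₀ - ε' by linarith)).achieves (by linarith) ?_
    (by linarith)
  -- `(1/s₀ − ε')(s₀ + δ) ≤ 1 − δ`
  have h1 : (1 / s₀ - ε') * (s₀ + δ) = 1 + δ / s₀ - ε' * s₀ - ε' * δ := by
    field_simp
    ring
  rw [h1]
  have h2 : δ / s₀ = ε' * s₀ / 2 := by
    rw [hδ]; field_simp
  rw [h2]
  have h3 : 0 ≤ ε' * δ := by positivity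
  nlinarith

/-- **Max-`k`-SAT, `k ≥ 3`: no polynomial-size LP relaxation has integrality gap below
`2^k/(2^k − 1)`** (`k = 3`: "every such LP for Max 3-Sat has an integrality gap of 7/8"),
UNCONDITIONAL: for every `ε > 0` and `d ≥ k`, for all large `n`, no LP relaxation of Max-`k`-SAT on `n`
variables of size `≤ n^{d/2}` has integrality gap `< 2^k/(2^k−1) − ε`.
[cite: ChanEtAl2016, §1 (arXiv v3 p. 3) and Thm 3.1 (p. 9)] -/
theorem maxKSat_poly_lpGap {k : ℕ} (hk : 3 ≤ k) {ε : ℝ} (hε : 0 < ε) {d : ℕ} (hkd : k ≤ d) :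
    ∃ n₀ : ℕ, ∀ n : ℕ, n₀ ≤ n → ∀ R : ℕ, (R : ℝ) ≤ (n : ℝ) ^ ((d : ℝ) / 2) →
      ∀ L : LPRelaxation k n (maxKSatPreds k) R, ¬ L.GapLT ((2 : ℝ) ^ k / (2 ^ k - 1) - ε) := by
  have h2k : (8 : ℝ) ≤ 2 ^ k := by
    calc (8 : ℝ) = 2 ^ 3 := by norm_num
      _ ≤ 2 ^ k := pow_le_pow_right₀ one_le_two hk
  have hs₀ : (0 : ℝ) < 1 - 1 / 2 ^ k := by
    rw [sub_pos, div_lt_one (by positivity)]; linarith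
  have hs₁ : (1 : ℝ) - 1 / 2 ^ k < 1 := by
    have : (0 : ℝ) < 1 / 2 ^ k := by positivity
    linarith
  obtain ⟨n₀, hn₀⟩ := poly_lpGap_of_linearSAGap (maxKSatPreds k) hs₀ hs₁
    (Schoenebeck2008_maxKSatSA hk) hε (by omega) hkd
  refine ⟨n₀, fun n hn R hR L => ?_⟩
  have h := hn₀ n hn R hR L
  have hne : (2 : ℝ) ^ k - 1 ≠ 0 := by linarith
  rwa [show (1 : ℝ) / (1 - 1 / 2 ^ k) = 2 ^ k / (2 ^ k - 1) by field_simp] at h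

/-- **Max-`k`-XOR, `k ≥ 3`: no polynomial-size LP relaxation has integrality gap below `2`**,
UNCONDITIONAL. [cite: ChanEtAl2016, Thm 3.1 (arXiv v3 p. 9) and §3 (p. 9)] -/
theorem maxKXor_poly_lpGap {k : ℕ} (hk : 3 ≤ k) {ε : ℝ} (hε : 0 < ε) {d : ℕ} (hkd : k ≤ d) :
    ∃ n₀ : ℕ, ∀ n : ℕ, n₀ ≤ n → ∀ R : ℕ, (R : ℝ) ≤ (n : ℝ) ^ ((d : ℝ) / 2) →
      ∀ L : LPRelaxation k n (literalClosure (xorK k)) R, ¬ L.GapLT (2 - ε) := by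
  obtain ⟨n₀, hn₀⟩ := poly_lpGap_of_linearSAGap (literalClosure (xorK k)) (s₀ := 1 / 2)
    (by norm_num) (by norm_num) (Schoenebeck2008_maxKXorSA hk) hε (by omega) hkd
  refine ⟨n₀, fun n hn R hR L => ?_⟩
  have h := hn₀ n hn R hR L
  rwa [show (1 : ℝ) / (1 / 2) - ε = 2 - ε by norm_num] at h

/-- **Parity-implied predicates, `k ≥ 3`: no polynomial-size LP relaxation of Max-CSP(`P`) beats the
random-assignment ratio `2^k/|P⁻¹(1)|`**, UNCONDITIONAL (for `P` not identically true).
[cite: ChanEtAl2016, Thm 3.1 (arXiv v3 p. 9) with §1.1 (p. 4: "[BGMT12]")] -/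
theorem parityImplied_poly_lpGap {k : ℕ} (hk : 3 ≤ k) {P : (Fin k → Bool) → Bool}
    (hP : ∀ y, xorK k y = true → P y = true) (hPne : ∃ y, P y = false)
    {ε : ℝ} (hε : 0 < ε) {d : ℕ} (hkd : k ≤ d) :
    ∃ n₀ : ℕ, ∀ n : ℕ, n₀ ≤ n → ∀ R : ℕ, (R : ℝ) ≤ (n : ℝ) ^ ((d : ℝ) / 2) →
      ∀ L : LPRelaxation k n (literalClosure P) R,
        ¬ L.GapLT ((2 : ℝ) ^ k / ((univ : Finset (Fin k → Bool)).filter fun y => P y = true).card - ε) := by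
  set NP := ((univ : Finset (Fin k → Bool)).filter fun y => P y = true).card with hNP
  have hNP0 : (0 : ℝ) < NP := by exact_mod_cast card_filter_pred_pos_of_parityImplied (by omega) hP
  have hNPlt : (NP : ℝ) < 2 ^ k := by exact_mod_cast card_filter_pred_lt_of_exists_false hPne
  have h2k : (0 : ℝ) < 2 ^ k := by positivity
  have hs₀ : (0 : ℝ) < NP / 2 ^ k := by positivity
  have hs₁ : (NP : ℝ) / 2 ^ k < 1 := by rw [div_lt_one h2k]; exact hNPlt
  obtain ⟨n₀, hn₀⟩ := poly_lpGap_of_linearSAGap (literalClosure P) hs₀ hs₁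
    (Schoenebeck2008_parityImplied_SA hk hP) hε (by omega) hkd
  refine ⟨n₀, fun n hn R hR L => ?_⟩
  have h := hn₀ n hn R hR L
  rwa [one_div_div] at h

/-! ### Max Cut (conditional on the [CMM09] Sherali–Adams gap) -/

/-- **Max Cut: polynomial-size LPs do not `(1 − ε, 1/2 + ε)`-approximate**, conditional on the
Charikar–Makarychev–Makarychev `n^γ`-round Sherali–Adams gap (`CharikarMakarychevMakarychev2009_maxCutSA`):
for every `ε > 0` and `d ≥ 2`, for all large `n`, no LP relaxation of Max Cut on `n` vertices of
size `≤ n^{d/2}` achieves a `(1 − ε, 1/2 + ε)`-approximation.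
[cite: ChanEtAl2016, §1 (arXiv v3 p. 3) and Thm 3.1 (p. 9: "known Sherali–Adams gaps for Max Cut [CMM09]")] -/
theorem maxCut_poly_lp_of_CMM (hCMM : CharikarMakarychevMakarychev2009_maxCutSA) {ε : ℝ}
    (hε : 0 < ε) {d : ℕ} (hd : 2 ≤ d) :
    ∃ n₀ : ℕ, ∀ n : ℕ, n₀ ≤ n → ∀ R : ℕ, (R : ℝ) ≤ (n : ℝ) ^ ((d : ℝ) / 2) →
      ∀ L : LPRelaxation 2 n maxCutPreds R, ¬ L.Achieves (1 - ε) (1 / 2 + ε) := by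
  obtain ⟨γ, hγ, n₁, H⟩ := hCMM ε hε
  -- an instance size `m` with `⌊m^γ⌋ ≥ d`
  set m : ℕ := max n₁ ⌈(d : ℝ) ^ (1 / γ)⌉₊ with hm
  have hm₁ : n₁ ≤ m := le_max_left _ _
  have hdm : d ≤ ⌊(m : ℝ) ^ γ⌋₊ := by
    refine Nat.le_floor ?_
    have h1 : (d : ℝ) ^ (1 / γ) ≤ m := by
      have : (⌈(d : ℝ) ^ (1 / γ)⌉₊ : ℝ) ≤ m := by rw [hm]; exact_mod_cast le_max_right _ _
      exact (Nat.le_ceil _).trans this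
    calc (d : ℝ) = ((d : ℝ) ^ (1 / γ)) ^ γ := by
          rw [one_div, Real.rpow_inv_rpow (Nat.cast_nonneg d) hγ.ne']
      _ ≤ (m : ℝ) ^ γ := Real.rpow_le_rpow (by positivity) h1 hγ.le
  exact ChanEtAl2016_thm31_holds 2 d maxCutPreds (1 - ε) (1 / 2 + ε) (by omega) hd m
    (not_saAchieves_of_le (H m hm₁) hdm)

/-- **Max Cut: "every polynomial-sized LP for Max Cut has an integrality gap of 1/2"**, conditional on
`CharikarMakarychevMakarychev2009_maxCutSA`: for every `ε > 0` and `d ≥ 2`, for all large `n`, no LP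
relaxation of Max Cut on `n` vertices of size `≤ n^{d/2}` has integrality gap `< 2 − ε`.
[cite: ChanEtAl2016, §1 (arXiv v3 p. 3: "answering a question from [BraunFPS12]") and Thm 3.1 (p. 9)] -/
theorem maxCut_poly_lpGap_of_CMM (hCMM : CharikarMakarychevMakarychev2009_maxCutSA) {ε : ℝ}
    (hε : 0 < ε) {d : ℕ} (hd : 2 ≤ d) :
    ∃ n₀ : ℕ, ∀ n : ℕ, n₀ ≤ n → ∀ R : ℕ, (R : ℝ) ≤ (n : ℝ) ^ ((d : ℝ) / 2) →
      ∀ L : LPRelaxation 2 n maxCutPreds R, ¬ L.GapLT (2 - ε) := by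
  -- WLOG `ε ≤ 1`; margin `δ = ε'/8`
  set ε' : ℝ := min ε 1 with hε'
  have hε'0 : 0 < ε' := lt_min hε one_pos
  have hε'1 : ε' ≤ 1 := min_le_right _ _
  have hε'ε : ε' ≤ ε := min_le_left _ _
  obtain ⟨n₀, hn₀⟩ := maxCut_poly_lp_of_CMM hCMM (ε := ε' / 8) (by positivity) hd
  refine ⟨n₀, fun n hn R hR L hgap => hn₀ n hn R hR L ?_⟩
  refine (hgap.mono (show 2 - ε ≤ 2 - ε' by linarith)).achieves (by linarith) ?_ (by linarith)
  nlinarith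

end Literature.Combinatorics.Optimization

end
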